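import Summits.AnomalousDissipation.AnomalousDissipation.Theorems.QuarticGate.Negative.LevelCeiling
import Literature.Analysis.FunctionSpaces.TorusTrigPoly

/-!
# Triage scratch (crux-triage r1, triager 2): card `rayleigh-floor-one-trajectory`

The card's `RatioFloor` (SketchIdeator3.lean, verbatim copy below) omits `f ≠ 0`; it is then
inhabited by `f = 0`, `μ = δ₀` (all rows vanish, energy `0`, dissipation `0`, `r·0 ≤ 0`), so the
announced first lemma `gil_of_ratioFloor : RatioFloor → GalerkinInvariantLoud` would prove the open
crux outright — it cannot be proved by the card's argument (the f-test energy floor needs `f ≠ 0`).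
Fix: add `f ≠ 0` (as card `taylor-cone-homogenisation` does in `TaylorScaleEnsemble`).
-/

namespace TriageR1K2

open MeasureTheory Filter Topology Set
open scoped ENNReal
open Literature.Analysis.FunctionSpaces Literature.Analysis.FluidPDE
open Summit.AnomalousDissipation.AnomalousDissipation.Theses.MomentParity
open Summit.AnomalousDissipation.AnomalousDissipation.Theorems.QuarticGate.Negative
  (mFourierCoeff_coe_zero nsGeneratorPairing_zero_zero)

/-- verbatim from SketchIdeator3.lean -/
def IsBandTest (N : ℕ) (g : UnitAddTorus (Fin 3) → EuclideanSpace ℝ (Fin 3)) : Prop :=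
  Torus.IsSmooth g ∧ Torus.IsDivFree g ∧ Torus.HasZeroMean g ∧
    ∀ k ∉ (Torus.freqBall N).erase (0 : Fin 3 → ℤ),
      UnitAddTorus.mFourierCoeff (EuclideanSpace.complexify ∘ g) k = 0

/-- verbatim from SketchIdeator3.lean -/
def IsLevelInvariant (ν : ℝ) (N : ℕ) (f : UnitAddTorus (Fin 3) → EuclideanSpace ℝ (Fin 3)) (R : ℝ)
    (μ : Measure (Torus.energySpace (Fin 3))) : Prop :=
  IsProbabilityMeasure μ ∧
  (∀ᵐ (u : Torus.energySpace (Fin 3)) ∂μ, (∀ k ∉ (Torus.freqBall N).erase (0 : Fin 3 → ℤ),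
    UnitAddTorus.mFourierCoeff (EuclideanSpace.complexify ∘
      (u.1 : UnitAddTorus (Fin 3) → EuclideanSpace ℝ (Fin 3))) k = 0)) ∧
  (∀ᵐ u ∂μ, ‖u‖ ≤ R) ∧
  (∀ (m : ℕ) (g : Fin m → UnitAddTorus (Fin 3) → EuclideanSpace ℝ (Fin 3))
      (P : MvPolynomial (Fin m) ℝ), (∀ i, IsBandTest N (g i)) →
    Integrable (fun u => Torus.nsGeneratorPairing ν f u (fun x => ∑ i : Fin m,
      (MvPolynomial.eval (fun j => Torus.pairing u.1 (g j)) (MvPolynomial.pderiv i P)) • g i x)) μ ∧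
    ∫ u, Torus.nsGeneratorPairing ν f u (fun x => ∑ i : Fin m,
      (MvPolynomial.eval (fun j => Torus.pairing u.1 (g j)) (MvPolynomial.pderiv i P)) • g i x) ∂μ = 0)

/-- verbatim from SketchIdeator3.lean -/
def IsForce (f : UnitAddTorus (Fin 3) → EuclideanSpace ℝ (Fin 3)) : Prop :=
  Torus.IsSmooth f ∧ Torus.IsDivFree f ∧ Torus.HasZeroMean f

/-- verbatim from SketchIdeator3.lean -/
def RatioFloor : Prop :=
  ∃ f : UnitAddTorus (Fin 3) → EuclideanSpace ℝ (Fin 3), IsForce f ∧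
    ∃ (ν : ℕ → ℝ) (r : ℝ), (∀ j, 0 < ν j) ∧ Tendsto ν atTop (nhds 0) ∧ 0 < r ∧
      ∀ j : ℕ, ∃ R : ℝ, ∃ᶠ N in atTop, ∃ μ, IsLevelInvariant (ν j) N f R μ ∧
        r * Torus.ensembleEnergy μ ≤ Torus.ensembleDissipation (ν j) μ

/-- `δ₀` with `f = 0` satisfies the invariant clauses (cf. Disproof `isGILWitness_dirac_zero`). -/
theorem isLevelInvariant_dirac_zero (ν : ℝ) (N : ℕ) :
    IsLevelInvariant ν N (fun _ => 0) 0 (Measure.dirac (0 : Torus.energySpace (Fin 3))) := by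
  haveI : MeasurableSingletonClass (Torus.energySpace (Fin 3)) :=
    OpensMeasurableSpace.toMeasurableSingletonClass
  refine ⟨inferInstance, ?_, ?_, ?_⟩
  · rw [ae_dirac_eq]
    simp only [Filter.eventually_pure]
    intro k _
    exact mFourierCoeff_coe_zero k
  · rw [ae_dirac_eq]
    simp
  · intro m g P _
    refine ⟨Torus.integrable_dirac _ _, ?_⟩
    rw [integral_dirac]
    exact nsGeneratorPairing_zero_zero ν _

/-- **`RatioFloor` is trivially inhabited** (`f = 0`, `ν_j = 1/(j+1)`, `r = 1`, `μ = δ₀`). -/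
theorem ratioFloor_trivial : RatioFloor := by
  have hzero : (Torus.realTrigPoly (∅ : Finset (Fin 3 → ℤ)) (0 : (Fin 3 → ℤ) → EuclideanSpace ℂ (Fin 3)))
      = fun _ => 0 := Torus.realTrigPoly_zero ∅
  refine ⟨fun _ => 0, ⟨Torus.isSmooth_const _, ?_, ?_⟩, fun j => 1 / ((j : ℝ) + 1), 1,
    fun j => by positivity, tendsto_one_div_add_atTop_nhds_zero_nat, one_pos, fun j => ⟨0, ?_⟩⟩
  · rw [← hzero]
    exact Torus.isDivFree_realTrigPoly fun k hk => by simp at hk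
  · simp [Torus.HasZeroMean]
  · refine Frequently.of_forall fun N => ⟨_, isLevelInvariant_dirac_zero _ N, ?_⟩
    haveI : MeasurableSingletonClass (Torus.energySpace (Fin 3)) :=
      OpensMeasurableSpace.toMeasurableSingletonClass
    have hE : Torus.ensembleEnergy (Measure.dirac (0 : Torus.energySpace (Fin 3))) = 0 := by
      simp [Torus.ensembleEnergy, integral_dirac]
    have hD : 0 ≤ Torus.ensembleDissipation (1 / ((j : ℝ) + 1))
        (Measure.dirac (0 : Torus.energySpace (Fin 3))) :=
      mul_nonneg (by positivity) ENNReal.toReal_nonneg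
    rw [hE, mul_zero]
    exact hD

/-- Hence the card's announced `gil_of_ratioFloor : RatioFloor → GalerkinInvariantLoud` is, as typed,
equivalent to the crux itself. -/
theorem gil_of_ratioFloor_iff :
    (RatioFloor → GalerkinInvariantLoud) ↔ GalerkinInvariantLoud :=
  ⟨fun h => h ratioFloor_trivial, fun h _ => h⟩

end TriageR1K2
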